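import Literature.Analysis.SegalBargmann.FockHeisenbergSchur
import HarnessLib

/-!
# Strong continuity of the Schrödinger representation `ρ(p,q)` on `L²(ℝ^σ)` (Folland 1989, §1.3)

Topic `Analysis/SegalBargmann`; namespace `Literature.Analysis.SegalBargmann`.

G. B. Folland, *Harmonic Analysis in Phase Space* (1989), §1.3 (1.25): "`ρ(p,q,t)f(x) = e^{2πit+2πiqx+πipq}f(x+p)`
is a unitary representation of `𝐇_n`" — in particular STRONGLY CONTINUOUS: for every `f ∈ L²(ℝ^σ)` the orbit map
`(p,q) ↦ ρ(p,q) f` is continuous.  This file proves that for the tree's operators `rho p q` (`SchrodingerWeyl`),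
through the coherent states `k_v = cohL2 v` (`FockReproducingKernel`, `FockHeisenbergSchur`):

* §1 `inner_cohL2_cohL2` (the Gram kernel `⟪k_u, k_v⟫ = e^{π u·v̄}`) and **`continuous_cohL2`** (`v ↦ k_v` is
  continuous into `L²(ℝ^σ)` — a map into a Hilbert space with continuous Gram kernel is continuous);
* §2 **`rho_cohL2`** — Folland (1.72) in the Schrödinger model: `ρ(p,q) k_v = e^{-(π/2)|w|² + π w·v̄} k_{v - w}`,
  `w = p + iq`; hence `continuous_rho_cohL2`;
* §3 `continuous_apply_of_dense` — a uniformly bounded family of operators whose orbit maps are continuous on a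
  dense subspace has all orbit maps continuous (`ε/3`);
* §4 **`continuous_rho_apply`**: `(p,q) ↦ ρ(p,q) f` is continuous for every `f ∈ L²(ℝ^σ)` (coherent states are
  total, `dense_span_cohL2`).

Everything is PROVED (Mathlib + tree); no cited statement is used as a hypothesis.

## References

* [Folland1989] G. B. Folland, *Harmonic Analysis in Phase Space*, Princeton University Press, 1989, §1.3
  (1.25), (1.72) (doi:10.1515/9781400882427).
-/

noncomputable section

open MeasureTheory Complex Filter
open scoped InnerProductSpace ComplexConjugate Real Topology

namespace Literature.Analysis.SegalBargmann

set_option autoImplicit false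

variable {σ : Type*} [Fintype σ]

/-! ## 1. The Gram kernel of the coherent states; continuity of `v ↦ k_v` -/

/-- **The Gram kernel of the coherent states**: `⟪k_u, k_v⟫ = e^{π Σ_k u_k v̄_k}` (the reproducing property read on
two representers). [cite: Folland1989, (1.66)] -/
theorem inner_cohL2_cohL2 (u v : σ → ℂ) :
    ⟪(cohL2 u : Lp ℂ 2 (volume : Measure (σ → ℝ))), cohL2 v⟫_ℂ = cexp ((π : ℂ) * ∑ k, u k * conj (v k)) := by
  rw [inner_cohL2_left, bargmannFun_cohL2]

/-- The Gram kernel is jointly continuous. [cite: Folland1989, (1.66)] -/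
theorem continuous_inner_cohL2_cohL2 :
    Continuous fun p : (σ → ℂ) × (σ → ℂ) => ⟪(cohL2 p.1 : Lp ℂ 2 (volume : Measure (σ → ℝ))), cohL2 p.2⟫_ℂ := by
  simp_rw [inner_cohL2_cohL2]
  fun_prop

/-- `‖k_u − k_{u₀}‖²` through the Gram kernel. [cite: Folland1989, (1.66)] -/
theorem norm_cohL2_sub_sq (u u₀ : σ → ℂ) :
    ‖(cohL2 u : Lp ℂ 2 (volume : Measure (σ → ℝ))) - cohL2 u₀‖ ^ 2 =
      RCLike.re (cexp ((π : ℂ) * ∑ k, u k * conj (u k))) -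
        2 * RCLike.re (cexp ((π : ℂ) * ∑ k, u k * conj (u₀ k))) +
          RCLike.re (cexp ((π : ℂ) * ∑ k, u₀ k * conj (u₀ k))) := by
  rw [norm_sub_sq (𝕜 := ℂ), ← inner_self_eq_norm_sq (𝕜 := ℂ), ← inner_self_eq_norm_sq (𝕜 := ℂ),
    inner_cohL2_cohL2, inner_cohL2_cohL2, inner_cohL2_cohL2]

/-- **`v ↦ k_v` is continuous into `L²(ℝ^σ)`**: `‖k_u - k_{u₀}‖²` is a continuous function of `u` (continuous Gram
kernel) vanishing at `u₀`. [cite: Folland1989, (1.66)] -/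
theorem continuous_cohL2 : Continuous (cohL2 : (σ → ℂ) → Lp ℂ 2 (volume : Measure (σ → ℝ))) := by
  rw [continuous_iff_continuousAt]
  intro u₀
  have hGc : Continuous fun u : σ → ℂ =>
      RCLike.re (cexp ((π : ℂ) * ∑ k, u k * conj (u k))) -
        2 * RCLike.re (cexp ((π : ℂ) * ∑ k, u k * conj (u₀ k))) +
          RCLike.re (cexp ((π : ℂ) * ∑ k, u₀ k * conj (u₀ k))) := by
    fun_prop
  rw [ContinuousAt, tendsto_iff_norm_sub_tendsto_zero]
  have ht := (hGc.tendsto u₀).sqrt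
  rw [← norm_cohL2_sub_sq u₀ u₀, sub_self, norm_zero, sq, mul_zero, Real.sqrt_zero] at ht
  refine ht.congr fun u => ?_
  rw [← norm_cohL2_sub_sq, Real.sqrt_sq (norm_nonneg _)]

/-! ## 2. `ρ(p,q)` on coherent states -/

omit [Fintype σ] in
/-- `(p,q) ↦ w = p + iq` is continuous. [cite: Folland1989, (1.71)] -/
theorem continuous_phasePt : Continuous fun w : (σ → ℝ) × (σ → ℝ) => phasePt w.1 w.2 := by
  refine continuous_pi fun k => ?_
  simp only [phasePt]
  fun_prop

variable [DecidableEq σ]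

/-- **Folland (1.72) in the Schrödinger model**: `ρ(p,q) k_v = e^{-(π/2)|w|² + π w·v̄} • k_{v − w}`, `w = p + iq`.
[cite: Folland1989, (1.72)] -/
theorem rho_cohL2 (p q : σ → ℝ) (v : σ → ℂ) :
    rho p q (cohL2 v : Lp ℂ 2 (volume : Measure (σ → ℝ))) =
      cexp (∑ k, (-(π / 2 : ℂ) * (phasePt p q k * conj (phasePt p q k)) +
        π * (phasePt p q k * conj (v k)))) • cohL2 (v - phasePt p q) := by
  refine ext_of_bargmannFun fun z => ?_
  rw [bargmannFun_rho, bargmannFun_cohL2, bargmannFun_smul, bargmannFun_cohL2, rhoPhase, ← Complex.exp_add,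
    ← Complex.exp_add]
  congr 1
  rw [Finset.mul_sum, Finset.mul_sum, ← Finset.sum_add_distrib, ← Finset.sum_add_distrib]
  refine Finset.sum_congr rfl fun k _ => ?_
  simp only [Pi.add_apply, Pi.sub_apply, map_sub]
  ring

/-- `(p,q) ↦ ρ(p,q) k_v` is continuous. [cite: Folland1989, §1.3 (1.25), (1.72)] -/
theorem continuous_rho_cohL2 (v : σ → ℂ) :
    Continuous fun w : (σ → ℝ) × (σ → ℝ) => rho w.1 w.2 (cohL2 v : Lp ℂ 2 (volume : Measure (σ → ℝ))) := by
  simp_rw [rho_cohL2]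
  have hc : Continuous fun w : (σ → ℝ) × (σ → ℝ) =>
      cexp (∑ k, (-(π / 2 : ℂ) * (phasePt w.1 w.2 k * conj (phasePt w.1 w.2 k)) +
        π * (phasePt w.1 w.2 k * conj (v k)))) := by
    refine Complex.continuous_exp.comp (continuous_finsetSum _ fun k _ => ?_)
    have hk : Continuous fun w : (σ → ℝ) × (σ → ℝ) => phasePt w.1 w.2 k :=
      (continuous_apply k).comp continuous_phasePt
    fun_prop
  exact hc.smul ((continuous_cohL2 (σ := σ)).comp (continuous_const.sub continuous_phasePt))

/-! ## 3. Orbit maps: continuity on a dense subspace suffices -/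

omit [DecidableEq σ] in
/-- A uniformly bounded family of operators `T x` (`‖T x f‖ ≤ ‖f‖`) whose orbit maps `x ↦ T x f` are continuous
for `f` in a dense subspace has ALL orbit maps continuous (`ε/3` argument). [cite: Folland1989, §1.3 (1.25)] -/
theorem continuous_apply_of_dense {X : Type*} [TopologicalSpace X] {E F : Type*} [NormedAddCommGroup E]
    [NormedSpace ℂ E] [NormedAddCommGroup F] [NormedSpace ℂ F] (T : X → E →L[ℂ] F)
    (hT : ∀ (x : X) (f : E), ‖T x f‖ ≤ ‖f‖) (S : Submodule ℂ E) (hS : Dense (S : Set E))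
    (hc : ∀ f ∈ S, Continuous fun x => T x f) (f : E) : Continuous fun x => T x f := by
  rw [continuous_iff_continuousAt]
  intro x₀
  rw [ContinuousAt, Metric.tendsto_nhds]
  intro ε hε
  have hε3 : 0 < ε / 3 := by positivity
  obtain ⟨d, hdS, hd⟩ : ∃ d ∈ (S : Set E), dist f d < ε / 3 := by
    obtain ⟨d, hd1, hd2⟩ := (Metric.dense_iff.mp hS) f (ε / 3) hε3
    exact ⟨d, hd2, Metric.mem_ball'.mp hd1⟩
  have h1 : ∀ᶠ x in 𝓝 x₀, dist (T x d) (T x₀ d) < ε / 3 :=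
    Metric.tendsto_nhds.mp ((hc d hdS).tendsto x₀) (ε / 3) hε3
  filter_upwards [h1] with x hx
  have e1 : dist (T x f) (T x d) < ε / 3 := by
    rw [dist_eq_norm, ← map_sub]
    exact (hT x _).trans_lt (by rwa [← dist_eq_norm])
  have e2 : dist (T x₀ d) (T x₀ f) < ε / 3 := by
    rw [dist_eq_norm, ← map_sub]
    exact (hT x₀ _).trans_lt (by rwa [← dist_eq_norm, dist_comm])
  calc dist (T x f) (T x₀ f) ≤ dist (T x f) (T x d) + dist (T x d) (T x₀ d) + dist (T x₀ d) (T x₀ f) :=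
        dist_triangle4 _ _ _ _
    _ < ε / 3 + ε / 3 + ε / 3 := by gcongr
    _ = ε := by ring

/-! ## 4. Strong continuity of `ρ` -/

/-- **Strong continuity of the Schrödinger representation on `L²(ℝ^σ)`**: for every `f ∈ L²(ℝ^σ)` the orbit
map `(p,q) ↦ ρ(p,q) f` is continuous. [cite: Folland1989, §1.3 (1.25)] -/
theorem continuous_rho_apply (f : Lp ℂ 2 (volume : Measure (σ → ℝ))) : Continuous fun w : (σ → ℝ) × (σ → ℝ) => rho w.1 w.2 f := by
  have h := continuous_apply_of_dense
    (fun w : (σ → ℝ) × (σ → ℝ) => ((rho w.1 w.2).toContinuousLinearEquiv : (Lp ℂ 2 (volume : Measure (σ → ℝ))) →L[ℂ] Lp ℂ 2 (volume : Measure (σ → ℝ))))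
    (fun w g => (LinearIsometryEquiv.norm_map _ _).le) (Submodule.span ℂ (Set.range (cohL2 (σ := σ))))
    dense_span_cohL2 (fun g hg => ?_) f
  · exact h
  · refine Submodule.span_induction (p := fun g _ => Continuous fun w : (σ → ℝ) × (σ → ℝ) =>
      ((rho w.1 w.2).toContinuousLinearEquiv : (Lp ℂ 2 (volume : Measure (σ → ℝ))) →L[ℂ] Lp ℂ 2 (volume : Measure (σ → ℝ))) g) ?_ ?_ ?_ ?_ hg
    · rintro _ ⟨v, rfl⟩
      exact continuous_rho_cohL2 v
    · simp only [map_zero]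
      exact continuous_const
    · intro g g' _ _ hg hg'
      simp only [map_add]
      exact hg.add hg'
    · intro c g _ hg
      simp only [map_smul]
      exact hg.const_smul c

end Literature.Analysis.SegalBargmann

end
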